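import Mathlib
import HarnessLib
import Summits.HubbardSuperconductivity.HubbardSuperconductivity.Theorems.KLProgrammeKLRegimeSplitTwoLegMomentsFromGrid

/-!
# Route `KLProgramme` — ENGINE child 19918, two-leg slot: the (E3d) FIELD STRENGTH from the TIME moment of a GRID kernel

Cell `gate-hubbard-kl`, seat p1b (g7).  Companion of `…TwoLegMomentsFromGrid` (spatial moments from a grid element `G = map (gridSub) W`): the field
strength `z(k⃗) = 1 − [Im Σ(ω₀,k⃗) − Im Σ(−ω₀,k⃗)]/(2ω₀)` read from the TIME first moment of `W`'s two-leg kernel on the grid — the input `hz` of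
`twoLegCoreT_zero/succ_of_momentumSizes` (`…TwoLegCoreTMomentum`), again with the constant `2|P|/(|β|L²)` and no analysis map:

* `norm_selfEnergy_omega0_sub_rev_map_gridSub_le` — `‖Σ_G((ω₀,k⃗),σ) − Σ_G((−ω₀,k⃗),σ)‖ ≤ (4ω₀/(|β|L²))·Σ_{p₀,p₁} |τ_{p₀} − τ_{p₁}|·‖kernel W 2 (p₀,p₁)‖`;
* **`abs_fieldStrength_map_gridSub_sub_one_le`** — `|fieldStrength β G k⃗ − 1| ≤ (2|P|/(|β|L²))·Bᵗ` whenever for every grid point `p₀` and both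
  spins `Σ_{p₁} |τ_{p₀} − τ_{p₁}|·‖kernel W 2 ((p₀,σ,+),(p₁,σ,−))‖ ≤ Bᵗ`.

Proofs only; no definitions; nothing about the model is asserted.  References: BGM 2006 §2.4 (2.36) [cite: BenfattoGiulianiMastropietro2006].
-/

noncomputable section

namespace Summit.HubbardSuperconductivity.HubbardSuperconductivity.Theorems.TwoLegFourier

set_option linter.dupNamespace false -- summit = problem name (single-conjunct summit), D-0017

open Finset Complex
open Literature.MathematicalPhysics.QuantumLattice Literature.Probability.LatticeModels GrassmannAlgebra
open Summit.HubbardSuperconductivity.HubbardSuperconductivity.Theorems.KLRegimeSplit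

variable {L M : ℕ} [NeZero L] {P : Type*} [Fintype P] [DecidableEq P]

/-- `‖e^{ia} − e^{−ia}‖ ≤ 2|a|` for real `a`. -/
theorem norm_cexp_mul_I_sub_cexp_neg_le (a : ℝ) :
    ‖Complex.exp ((a : ℂ) * Complex.I) - Complex.exp (-((a : ℂ) * Complex.I))‖ ≤ 2 * |a| := by
  have h : Complex.exp ((a : ℂ) * Complex.I) - Complex.exp (-((a : ℂ) * Complex.I)) = 2 * Complex.I * Complex.sin a := by
    rw [Complex.sin, ← neg_mul]
    field_simp
    ring_nf
    rw [Complex.I_sq]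
    ring
  rw [h, norm_mul, norm_mul, Complex.norm_two, Complex.norm_I, mul_one, ← Complex.ofReal_sin, Complex.norm_real, Real.norm_eq_abs]
  exact mul_le_mul_of_nonneg_left (Real.abs_sin_le_abs) (by norm_num)

/-- **The two lowest-frequency self-energies of `map S W` differ by the TIME moment of the grid kernel**:
`‖Σ((ω₀,k⃗),σ) − Σ((−ω₀,k⃗),σ)‖ ≤ (4ω₀/(|β|L²))·Σ_{p₀,p₁} |τ_{p₀} − τ_{p₁}|·‖kernel W 2 ((p₀,σ,+),(p₁,σ,−))‖`, `ω₀ = π/β`. -/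
theorem norm_selfEnergy_omega0_sub_rev_map_gridSub_le [NeZero M] {β : ℝ} (hβ : β ≠ 0) (x : P → TorusSite 2 L) (τ : P → ℝ)
    (W : GrassmannAlgebra ℂ (GridLeg P)) (k : TorusSite 2 L) (σ : Fin 2) :
    ‖selfEnergy L M β (ExteriorAlgebra.map (Matrix.toLin' (gridSubMatrix L M β x τ)) W) (omega0 M, k) σ -
        selfEnergy L M β (ExteriorAlgebra.map (Matrix.toLin' (gridSubMatrix L M β x τ)) W) ((omega0 M).rev, k) σ‖ ≤
      4 * (Real.pi / |β|) / (|β| * (L : ℝ) ^ 2) * ∑ p : Fin 2 → P, |τ (p 0) - τ (p 1)| * ‖kernel ℂ W 2 (fun i => ((p i, σ), i))‖ := by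
  have hL : (0 : ℝ) < (L : ℝ) ^ 2 := by have := NeZero.ne L; positivity
  have hβ0 : 0 < |β| := abs_pos.2 hβ
  rw [selfEnergy_eq_vertexFn, selfEnergy_eq_vertexFn, kernel_two_map_gridSub, kernel_two_map_gridSub, ← mul_sub, ← sum_sub_distrib]
  simp only [matsubaraFreq_omega0, matsubaraFreq_omega0_rev]
  have hterm : ∀ p : Fin 2 → P,
      ((1 / (β * (L : ℝ) ^ 2) : ℝ) : ℂ) ^ 2 *
          (Complex.exp (((Real.pi / β * (τ (p 0) - τ (p 1)) : ℝ) : ℂ) * Complex.I) * torusChar k (x (p 0) - x (p 1))) *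
            kernel ℂ W 2 (fun i => ((p i, σ), i)) -
        ((1 / (β * (L : ℝ) ^ 2) : ℝ) : ℂ) ^ 2 *
          (Complex.exp (((-(Real.pi / β) * (τ (p 0) - τ (p 1)) : ℝ) : ℂ) * Complex.I) * torusChar k (x (p 0) - x (p 1))) *
            kernel ℂ W 2 (fun i => ((p i, σ), i)) =
      ((1 / (β * (L : ℝ) ^ 2) : ℝ) : ℂ) ^ 2 * (torusChar k (x (p 0) - x (p 1)) * kernel ℂ W 2 (fun i => ((p i, σ), i))) *
        (Complex.exp (((Real.pi / β * (τ (p 0) - τ (p 1)) : ℝ) : ℂ) * Complex.I) -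
          Complex.exp (-((((Real.pi / β * (τ (p 0) - τ (p 1)) : ℝ) : ℂ)) * Complex.I))) := by
    intro p
    have e : (((-(Real.pi / β) * (τ (p 0) - τ (p 1)) : ℝ) : ℂ) * Complex.I) = -((((Real.pi / β * (τ (p 0) - τ (p 1)) : ℝ) : ℂ)) * Complex.I) := by
      push_cast; ring
    rw [e]; ring
  simp_rw [hterm]
  rw [norm_mul, Complex.norm_real, Real.norm_eq_abs, mul_sum]
  refine (mul_le_mul_of_nonneg_left (norm_sum_le _ _) (abs_nonneg _)).trans ?_
  rw [mul_sum]
  refine sum_le_sum fun p _ => ?_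
  rw [norm_mul, norm_mul, norm_mul, norm_torusChar, one_mul, norm_pow, Complex.norm_real, Real.norm_eq_abs]
  have hph := norm_cexp_mul_I_sub_cexp_neg_le (Real.pi / β * (τ (p 0) - τ (p 1)))
  have hk0 : 0 ≤ ‖kernel ℂ W 2 (fun i => ((p i, σ), i))‖ := norm_nonneg _
  have e1 : |2 * (β * (L : ℝ) ^ 2)| = 2 * (|β| * (L : ℝ) ^ 2) := by rw [abs_mul, abs_two, abs_mul, abs_of_pos hL]
  have e2 : |1 / (β * (L : ℝ) ^ 2)| = 1 / (|β| * (L : ℝ) ^ 2) := by rw [abs_div, abs_one, abs_mul, abs_of_pos hL]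
  have e3 : |Real.pi / β * (τ (p 0) - τ (p 1))| = Real.pi / |β| * |τ (p 0) - τ (p 1)| := by
    rw [abs_mul, abs_div, abs_of_pos Real.pi_pos]
  calc |2 * (β * (L : ℝ) ^ 2)| * (|1 / (β * (L : ℝ) ^ 2)| ^ 2 * ‖kernel ℂ W 2 (fun i => ((p i, σ), i))‖ *
        ‖Complex.exp (((Real.pi / β * (τ (p 0) - τ (p 1)) : ℝ) : ℂ) * Complex.I) -
          Complex.exp (-((((Real.pi / β * (τ (p 0) - τ (p 1)) : ℝ) : ℂ)) * Complex.I))‖)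
      ≤ |2 * (β * (L : ℝ) ^ 2)| * (|1 / (β * (L : ℝ) ^ 2)| ^ 2 * ‖kernel ℂ W 2 (fun i => ((p i, σ), i))‖ *
          (2 * |Real.pi / β * (τ (p 0) - τ (p 1))|)) := by gcongr
    _ = 4 * (Real.pi / |β|) / (|β| * (L : ℝ) ^ 2) * (|τ (p 0) - τ (p 1)| * ‖kernel ℂ W 2 (fun i => ((p i, σ), i))‖) := by
        rw [e1, e2, e3]
        field_simp
        ring

/-- **(E3d) FROM THE GRID: the field strength of `G = map S W` from the TIME first moment of `W`'s two-leg kernel** —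
`|fieldStrength β G k⃗ − 1| ≤ (2|P|/(|β|L²))·Bᵗ` if `Σ_{p₁} |τ_{p₀} − τ_{p₁}|·‖kernel W 2 ((p₀,σ,+),(p₁,σ,−))‖ ≤ Bᵗ` for every `p₀` and both spins. -/
theorem abs_fieldStrength_map_gridSub_sub_one_le [NeZero M] {β : ℝ} (hβ : 0 < β) (x : P → TorusSite 2 L) (τ : P → ℝ)
    (W : GrassmannAlgebra ℂ (GridLeg P)) (k : TorusSite 2 L) {Bt : ℝ}
    (hBt : ∀ (σ : Fin 2) (p₀ : P), ∑ p₁ : P, |τ p₀ - τ p₁| * ‖kernel ℂ W 2 (fun i => ((![p₀, p₁] i, σ), i))‖ ≤ Bt) :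
    |fieldStrength L M β (ExteriorAlgebra.map (Matrix.toLin' (gridSubMatrix L M β x τ)) W) k - 1| ≤
      2 * (Fintype.card P : ℝ) / (|β| * (L : ℝ) ^ 2) * Bt := by
  set G := ExteriorAlgebra.map (Matrix.toLin' (gridSubMatrix L M β x τ)) W with hG
  have hL : (0 : ℝ) < (L : ℝ) ^ 2 := by have := NeZero.ne L; positivity
  have hβ' : |β| = β := abs_of_pos hβ
  -- the total time-weighted sum, sliced by the first point
  have htot : ∀ σ : Fin 2, ∑ p : Fin 2 → P, |τ (p 0) - τ (p 1)| * ‖kernel ℂ W 2 (fun i => ((p i, σ), i))‖ ≤ (Fintype.card P : ℝ) * Bt := by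
    intro σ
    have e : ∑ p : Fin 2 → P, |τ (p 0) - τ (p 1)| * ‖kernel ℂ W 2 (fun i => ((p i, σ), i))‖ =
        ∑ q : P × P, |τ q.1 - τ q.2| * ‖kernel ℂ W 2 (fun i => ((![q.1, q.2] i, σ), i))‖ := by
      refine Fintype.sum_equiv (finTwoArrowEquiv P) _ _ fun p => ?_
      simp only [finTwoArrowEquiv_apply]
      congr 3
      funext i; fin_cases i <;> rfl
    rw [e, Fintype.sum_prod_type]
    calc ∑ p₀ : P, ∑ p₁ : P, |τ p₀ - τ p₁| * ‖kernel ℂ W 2 (fun i => ((![p₀, p₁] i, σ), i))‖ ≤ ∑ _p₀ : P, Bt :=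
          sum_le_sum fun p₀ _ => hBt σ p₀
      _ = (Fintype.card P : ℝ) * Bt := by rw [sum_const, card_univ, nsmul_eq_mul]
  -- per spin
  have hspin : ∀ σ : Fin 2, |fieldStrengthSpin L M β G k σ - 1| ≤ 2 * (Fintype.card P : ℝ) / (|β| * (L : ℝ) ^ 2) * Bt := by
    intro σ
    have h := norm_selfEnergy_omega0_sub_rev_map_gridSub_le (L := L) (M := M) hβ.ne' x τ W k σ
    have hω : 0 < 2 * (Real.pi / β) := by positivity
    rw [fieldStrengthSpin, sub_sub_cancel_left, abs_neg, abs_div, abs_of_pos hω, div_le_iff₀ hω]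
    have him : |(selfEnergy L M β G (omega0 M, k) σ).im - (selfEnergy L M β G ((omega0 M).rev, k) σ).im| ≤
        ‖selfEnergy L M β G (omega0 M, k) σ - selfEnergy L M β G ((omega0 M).rev, k) σ‖ := by
      rw [← Complex.sub_im]
      exact Complex.abs_im_le_norm _
    refine him.trans (h.trans ?_)
    rw [hβ']
    have hc : 0 ≤ 4 * (Real.pi / β) / (β * (L : ℝ) ^ 2) := by positivity
    calc 4 * (Real.pi / β) / (β * (L : ℝ) ^ 2) * ∑ p : Fin 2 → P, |τ (p 0) - τ (p 1)| * ‖kernel ℂ W 2 (fun i => ((p i, σ), i))‖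
        ≤ 4 * (Real.pi / β) / (β * (L : ℝ) ^ 2) * ((Fintype.card P : ℝ) * Bt) := mul_le_mul_of_nonneg_left (htot σ) hc
      _ = 2 * (Fintype.card P : ℝ) / (β * (L : ℝ) ^ 2) * Bt * (2 * (Real.pi / β)) := by
          field_simp
          ring
  rw [fieldStrength]
  have e : (fieldStrengthSpin L M β G k 0 + fieldStrengthSpin L M β G k 1) / 2 - 1 =
      ((fieldStrengthSpin L M β G k 0 - 1) + (fieldStrengthSpin L M β G k 1 - 1)) / 2 := by ring
  rw [e, abs_div, abs_two]
  have htri := abs_add_le (fieldStrengthSpin L M β G k 0 - 1) (fieldStrengthSpin L M β G k 1 - 1)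
  have h0 := hspin 0
  have h1 := hspin 1
  linarith

end Summit.HubbardSuperconductivity.HubbardSuperconductivity.Theorems.TwoLegFourier

end
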